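import Summits.BirchSwinnertonDyer.Rank1Residual.ManinAdditive.CMTwinStevensMinimalMembers
import HarnessLib

/-!
# COR 46: C2 / C3 on the CM slices from the ROOT law E-es-152 + CLASSIFICATION (composition of COR 45.R⁺/45.S with THM 46)
(cell `bsd-f2-manin`, planner `es` g32, MEMO-es §46.5; T-es-51 part 2/2)

TYPER NOTE (typer g20, T-es-51 part 2/2).  SOURCE = HOME/es/g32/Sketch-es-g32.lean sha16 cc6f37ae87e431d3 §5 (l. 303–420) VERBATIM; imports part 1
`CMTwinStevensMinimalMembers.lean` (which carries §1–§4 and es's module docstring).  CONTENT (all PROVED, es): `exists_primitive_witness` (every period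
lattice has a p-primitive vector — discharges `hwit`/`hz` of COR 45.R⁺/45.S), **COR 46.R₂/R₃** `not_two/three_dvd_maninConstant_on_cmClass_two/three_of_rootLaw_of_classMembers`
(C2 / C3 for every optimal X₀(N)-datum on the CM slice with a second prime q² ∣ N ⟸ E-es-152_p ∧ SHAPE_p⁺ ∧ Faltings), COR 45.S with the witness discharged
`not_two/three_dvd_maninConstant₁_on_cmClass_two/three_of_rootLaw'`, and **COR 46.S⁺₂/S⁺₃** `not_two/three_dvd_maninConstant₁_on_cmClass_two/three_of_rootLaw_of_classMembers`
(the p-part of Stevens' c₁ = ±1 on the whole CM slice ⟸ E-es-152_p ∧ SHAPE_p⁺ ∧ Faltings — no witness, no level, no second prime).  Theorem-only file.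
PARTITION 0 · beyond-print theorem: no · bears_on stmt-BirchSwinnertonDyer-22967 / 22968 · BSD is not proved by this; C2/C3 OPEN.
-/

set_option autoImplicit false

noncomputable section

namespace Summit.BirchSwinnertonDyer.Rank1Residual.ManinAdditive.KatoCurve.CMTwinMinimal

open Complex Polynomial WeierstrassCurve Literature.NumberTheory.EllipticCurves
  Literature.NumberTheory.EllipticCurves.ModularForms
  Summit.BirchSwinnertonDyer.Rank1Residual.ManinAdditive.KatoCurve.CMOptimal
  Summit.BirchSwinnertonDyer.Rank1Residual.ManinAdditive.KatoCurve.CMOptimal.TwinLattice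

/-! ## §5 COR 46: C2 / C3 on the CM slices from the ROOT LAW E-es-152 + CLASSIFICATION (composition of COR 45.R⁺/45.S with THM 46;
the primitive-vector witness of COR 45 discharged) -/

section Cor46

open CongruenceSubgroup
open scoped MatrixGroups ModularForm

/-- Every period lattice carries a `p`-primitive vector: `z = ω₁` has `s·z ∉ p·Λ` for all `s` prime to `p` (indeed `p ∤ s`).
(Discharges the witness hypothesis `hwit` / `hz` of COR 45.R⁺ / 45.S.) -/
theorem exists_primitive_witness (L : PeriodPair) (p : ℤ) :
    ∃ z ∈ L.lattice, ∀ s : ℤ, ¬ p ∣ s → ∀ m ∈ L.lattice, (s : ℂ) * z ≠ (p : ℂ) * m := by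
  refine ⟨L.ω₁, L.ω₁_mem_lattice, fun s hs m hm h => hs ?_⟩
  obtain ⟨a, b, rfl⟩ := PeriodPair.mem_lattice.mp hm
  have key := (LinearIndependent.pair_iff.mp L.indep) ((s : ℝ) - p * a) (-(p * b)) (by
    simp only [Complex.real_smul]
    push_cast
    linear_combination h)
  refine ⟨a, ?_⟩
  have h1 : (s : ℝ) = p * a := sub_eq_zero.mp key.1
  exact_mod_cast h1

variable {N : ℕ} [NeZero N]

/-- **COR 46.R₂ — C2 (`2 ∤ c`) for EVERY optimal `X₀(N)`-datum on the `ℚ(i)`-CM slice off the pure-2-power levels**, conditional on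
the ROOT LAW E-es-152₂, the CLASSIFICATION SHAPE₂⁺ (classical) and `LFunction_eq_of_isIsogenous` (Faltings): COR 45.R₂⁺ ∘ THM 46₂,
witness discharged.  Remaining side conditions: the lattice-optimality clause `hD` of the datum, the twist-reduced root `V` of the class
(exists and is unique: SHAPE-CHECK-v1 649/649), and one odd prime `q` with `q² ∣ N` (every class except the twists by `±1, ±2` of `32a`,
`64a`, i.e. the `2`-power levels, which are Cremona-table checks). -/
theorem not_two_dvd_maninConstant_on_cmClass_two_of_rootLaw_of_classMembers
    (h152 : CMGammaOneRootLawTwoLocal) (hcl : CMClassMembersTwo) (hL : LFunction_eq_of_isIsogenous)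
    (W : WeierstrassCurve ℚ) [W.IsElliptic] [W.IsGloballyMinimal]
    (D : ModularParametrizationData W N)
    (hD : ∀ z ∈ D.L.lattice, ∃ w ∈ periodLattice D.f, z = D.c * w)
    (V : WeierstrassCurve ℚ) [V.IsElliptic] [V.IsGloballyMinimal] (LV : PeriodPair) (h6 : V.c₆ = 0)
    (hiso : WeierstrassCurve.IsIsogenous V W) (hLV : IsNeronLatticeOf (V.baseChange ℂ) LV)
    (hred : ∀ (W' : WeierstrassCurve ℚ) [W'.IsElliptic] [W'.IsGloballyMinimal],
        W'.j = 1728 → WeierstrassCurve.IsIsogenous V W' → (W'.c₄ = V.c₄ ∨ W'.c₄ = -4 * V.c₄))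
    {q : ℕ} (hq : q.Prime) (hq2 : q ≠ 2) (h4 : 2 ^ 2 ∣ N) (hqN : q ^ 2 ∣ N) :
    ¬ (2 : ℤ) ∣ D.maninConstant :=
  not_two_dvd_maninConstant_on_cmClass_two_of_rootLaw h152 (cmTwinStevensMinimalTwo_of_classMembers hcl) hL W D hD V LV
    h6 hiso hLV hred (by simpa using exists_primitive_witness LV 2) hq hq2 h4 hqN

/-- **COR 46.R₃ — C3 (`3 ∤ c`) for EVERY optimal `X₀(N)`-datum on the `ℚ(√−3)`-CM slice off the `2^a 3^b` levels**,
conditional on E-es-152₃, SHAPE₃⁺ and `LFunction_eq_of_isIsogenous`: COR 45.R₃⁺ ∘ THM 46₃, witness discharged. -/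
theorem not_three_dvd_maninConstant_on_cmClass_three_of_rootLaw_of_classMembers
    (h152 : CMGammaOneRootLawThreeLocal) (hcl : CMClassMembersThree) (hL : LFunction_eq_of_isIsogenous)
    (W : WeierstrassCurve ℚ) [W.IsElliptic] [W.IsGloballyMinimal]
    (D : ModularParametrizationData W N)
    (hD : ∀ z ∈ D.L.lattice, ∃ w ∈ periodLattice D.f, z = D.c * w)
    (V : WeierstrassCurve ℚ) [V.IsElliptic] [V.IsGloballyMinimal] (LV : PeriodPair) (h4 : V.c₄ = 0)
    (hiso : WeierstrassCurve.IsIsogenous V W) (hLV : IsNeronLatticeOf (V.baseChange ℂ) LV)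
    (hred : ∀ (W' : WeierstrassCurve ℚ) [W'.IsElliptic] [W'.IsGloballyMinimal],
        W'.j = 0 → WeierstrassCurve.IsIsogenous V W' → (W'.c₆ = V.c₆ ∨ W'.c₆ = -27 * V.c₆))
    {q : ℕ} (hq : q.Prime) (hq3 : q ≠ 3) (h9 : 3 ^ 2 ∣ N) (hqN : q ^ 2 ∣ N) :
    ¬ (3 : ℤ) ∣ D.maninConstant :=
  not_three_dvd_maninConstant_on_cmClass_three_of_rootLaw h152 (cmTwinStevensMinimalThree_of_classMembers hcl) hL W D hD V
    LV h4 hiso hLV hred (by simpa using exists_primitive_witness LV 3) hq hq3 h9 hqN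

/-- **COR 46.S₂ — the `2`-part of Stevens' `c₁ = ±1` for the `X₁(N)`-optimal curve of a `ℚ(i)`-CM class with `c₆ = 0`, from E-es-152₂
ALONE** (COR 45.S₂ with its witness discharged). -/
theorem not_two_dvd_maninConstant₁_on_cmClass_two_of_rootLaw' (h152 : CMGammaOneRootLawTwoLocal)
    (V : WeierstrassCurve ℚ) [V.IsElliptic] [V.IsGloballyMinimal] (D : Gamma1ParametrizationData V N)
    (hopt : D.IsOptimal) (h6 : V.c₆ = 0) : ¬ (2 : ℤ) ∣ D.maninConstant :=
  not_two_dvd_maninConstant₁_on_cmClass_two_of_rootLaw h152 V D hopt h6 (exists_primitive_witness D.L 2)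

/-- **COR 46.S₃** — the `3`-part of Stevens' `c₁ = ±1` on the `ℚ(√−3)`-CM slice (`c₄ = 0`) from E-es-152₃ alone, witness discharged. -/
theorem not_three_dvd_maninConstant₁_on_cmClass_three_of_rootLaw' (h152 : CMGammaOneRootLawThreeLocal)
    (V : WeierstrassCurve ℚ) [V.IsElliptic] [V.IsGloballyMinimal] (D : Gamma1ParametrizationData V N)
    (hopt : D.IsOptimal) (h4 : V.c₄ = 0) : ¬ (3 : ℤ) ∣ D.maninConstant :=
  not_three_dvd_maninConstant₁_on_cmClass_three_of_rootLaw h152 V D hopt h4 (exists_primitive_witness D.L 3)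

/-- **COR 46.S₂⁺ — the `2`-part of STEVENS' `c₁ = ±1` for the `X₁(N)`-optimal curve of EVERY `ℚ(i)`-CM class, whichever member
carries the optimal datum, with NO level hypothesis and NO second prime**: root law E-es-152₂ at the twist-reduced root `V`
(`Λ₁(f) ⊆ Λ_V ⊗ ℤ₍₂₎`), THM 46₂ (`Λ_V ⊆ Λ_W`), optimality `Λ_W = c₁ Λ₁(f)` ⟹ `Λ₁ ⊗ ℤ₍₂₎ ⊆ c₁ Λ₁ ⊗ ℤ₍₂₎` ⟹ `2 ∤ c₁`.
Inputs: E-es-152₂ (paper THEOREM 45⁺⁺, kernel conjecture), SHAPE₂⁺ (classical), `LFunction_eq_of_isIsogenous` (Faltings). -/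
theorem not_two_dvd_maninConstant₁_on_cmClass_two_of_rootLaw_of_classMembers
    (h152 : CMGammaOneRootLawTwoLocal) (hcl : CMClassMembersTwo) (hL : LFunction_eq_of_isIsogenous)
    (W : WeierstrassCurve ℚ) [W.IsElliptic] [W.IsGloballyMinimal] (D : Gamma1ParametrizationData W N)
    (hopt : D.IsOptimal)
    (V : WeierstrassCurve ℚ) [V.IsElliptic] [V.IsGloballyMinimal] (LV : PeriodPair) (h6 : V.c₆ = 0)
    (hiso : WeierstrassCurve.IsIsogenous V W) (hLV : IsNeronLatticeOf (V.baseChange ℂ) LV)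
    (hred : ∀ (W' : WeierstrassCurve ℚ) [W'.IsElliptic] [W'.IsGloballyMinimal],
        W'.j = 1728 → WeierstrassCurve.IsIsogenous V W' → (W'.c₄ = V.c₄ ∨ W'.c₄ = -4 * V.c₄)) :
    ¬ (2 : ℤ) ∣ D.maninConstant := by
  have hjV : V.j = 1728 := by
    have hΔ : V.Δ ≠ 0 := by rw [← WeierstrassCurve.coe_Δ']; exact V.Δ'.ne_zero
    have hc : V.c₄ ^ 3 = 1728 * V.Δ := by
      have := V.c_relation; rw [h6] at this; linear_combination -this
    rw [WeierstrassCurve.j, Units.val_inv_eq_inv_val, WeierstrassCurve.coe_Δ', hc]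
    field_simp
  have hfV : IsNewformOf V D.f := isNewformOf_of_isIsogenous hL D.isNewformOf hiso
  have hle : LV.lattice ≤ D.L.lattice :=
    cmTwinStevensMinimalTwo_of_classMembers hcl V W LV D.L hjV hiso hLV D.isNeronLattice hred
  refine not_dvd_maninConstant₁_of_rootLaw_of_witness D hopt (fun w hw => ?_) (exists_primitive_witness D.L 2)
  obtain ⟨s, hs, hsw⟩ := h152 V D.f LV h6 hfV hLV w hw
  exact ⟨s, hs, hle hsw⟩

/-- **COR 46.S₃⁺ — the `3`-part of Stevens' `c₁ = ±1` for the `X₁(N)`-optimal curve of EVERY `ℚ(√−3)`-CM class** (as 46.S₂⁺: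
E-es-152₃ at the root + THM 46₃ + optimality). -/
theorem not_three_dvd_maninConstant₁_on_cmClass_three_of_rootLaw_of_classMembers
    (h152 : CMGammaOneRootLawThreeLocal) (hcl : CMClassMembersThree) (hL : LFunction_eq_of_isIsogenous)
    (W : WeierstrassCurve ℚ) [W.IsElliptic] [W.IsGloballyMinimal] (D : Gamma1ParametrizationData W N)
    (hopt : D.IsOptimal)
    (V : WeierstrassCurve ℚ) [V.IsElliptic] [V.IsGloballyMinimal] (LV : PeriodPair) (h4 : V.c₄ = 0)
    (hiso : WeierstrassCurve.IsIsogenous V W) (hLV : IsNeronLatticeOf (V.baseChange ℂ) LV)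
    (hred : ∀ (W' : WeierstrassCurve ℚ) [W'.IsElliptic] [W'.IsGloballyMinimal],
        W'.j = 0 → WeierstrassCurve.IsIsogenous V W' → (W'.c₆ = V.c₆ ∨ W'.c₆ = -27 * V.c₆)) :
    ¬ (3 : ℤ) ∣ D.maninConstant := by
  have hjV : V.j = 0 := by simp [WeierstrassCurve.j, h4]
  have hfV : IsNewformOf V D.f := isNewformOf_of_isIsogenous hL D.isNewformOf hiso
  have hle : LV.lattice ≤ D.L.lattice :=
    cmTwinStevensMinimalThree_of_classMembers hcl V W LV D.L hjV hiso hLV D.isNeronLattice hred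
  refine not_dvd_maninConstant₁_of_rootLaw_of_witness D hopt (fun w hw => ?_) (exists_primitive_witness D.L 3)
  obtain ⟨s, hs, hsw⟩ := h152 V D.f LV h4 hfV hLV w hw
  exact ⟨s, hs, hle hsw⟩

end Cor46

end Summit.BirchSwinnertonDyer.Rank1Residual.ManinAdditive.KatoCurve.CMTwinMinimal

end
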